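import Mathlib
import HarnessLib
import Summits.Ventures.LatticeQCDFlow.Scoring.GaussianStudentScaleMixture
import Summits.Ventures.LatticeQCDFlow.Scoring.GaussianMeanSquareConcentration
import Summits.Ventures.LatticeQCDFlow.Scoring.GaussianAcceptanceSlope

/-!
# AN `O(1/n)` RATE FOR THE STUDENT-TYPE CALIBRATION:
# `N(0,1)([−q, q]) − L_{n+1}(q) ≤ (2·g_q(1/2)(q²/2 + 1) + 8)/n`

HONEST FRAMING: exact (Metropolis-corrected) sampling algorithms for lattice gauge theory;
figures of merit are autocorrelation/cost numbers at stated couplings and volumes; no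
continuum-physics claim.

Venture `LatticeQCDFlow` (cell pub-lqcd), topic `Scoring`; FANOUT row 4 (`s0-u1-b`, GEN-33).
NEW WORK of the cell (classical), no definition, nothing cited as a fact.

WHY (row 4).  `Scoring/GaussianStudentCountRate` bounds the deficit of the fixed-count calibration
`L_{n+1}(q) = E ψ_q(V_n)` below the nominal `ψ_q(1) = N(0,1)([−q,q])` by `ψ_q(1)·√(2/n)` — first
order.  The true order is `1/n`, and one more term gives it: since `E V_n = 1`, the deficit equals
`E h(V_n)` with `h(x) = ψ_q(1) + g_q(1)(x − 1) − ψ_q(x) ≥ 0` (tangent line of a concave function;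
`g_q = ψ_q'`, `Scoring/GaussianAcceptanceSlope`), and `h(x) ≤ K_q (x − 1)²` for all `x ≥ 0` with
`K_q = g_q(1/2)(q²/2 + 1) + 4ψ_q(1)`: on `[1/2, ∞)` by the mean value theorem and the Lipschitz
bound of `g_q`, on `[0, 1/2)` because `h ≤ ψ_q(1) ≤ 4ψ_q(1)(x − 1)²` there.  Hence
`deficit ≤ K_q · Var(V_n) = 2K_q/n` (`Scoring/GaussianMeanSquareConcentration`).  With `ψ_q(1) ≤ 1`:
`N(0,1)([−q,q]) − L_{n+1}(q) ≤ (2 g_q(1/2)(q²/2 + 1) + 8)/n`.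

## Content

* `acceptanceMass_tangent_sub_le_sq` (§1) — for `q ≥ 0`, `x ≥ 0`:
  `ψ_q(1) + g_q(1)(x − 1) − ψ_q(x) ≤ (g_q(1/2)(q²/2 + 1) + 4ψ_q(1))·(x − 1)²`.
* **`gaussianReal_sub_studentRatio_le_inv`** (§2) — `q ≥ 0`, `n ≥ 1`:
  `N(0,1)([−q,q]) − N^{⊗(n+1)}{|z₀| ≤ q√((Σ_{j≥1} z_j²)/n)} ≤ (2 g_q(1/2)(q²/2+1) + 8 N(0,1)([−q,q]))/n`.

Depends on `Scoring/GaussianStudentScaleMixture`, `Scoring/GaussianMeanSquareConcentration`,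
`Scoring/GaussianAcceptanceSlope` (row 4 GEN-33).  [ours] throughout.
-/

open MeasureTheory ProbabilityTheory Filter Topology Finset

namespace Summit.Ventures.LatticeQCDFlow.Scoring

open Set

/-! ## §1 The second-order bound for the tangent-line gap of `ψ_q` -/

section Tangent

/-- **`0 ≤ ψ_q(1) + g_q(1)(x − 1) − ψ_q(x) ≤ K_q (x − 1)²` for `x ≥ 0`**, with
`K_q = g_q(1/2)(q²/2 + 1) + 4ψ_q(1)` (only the upper bound is proved here; the lower bound is
concavity and is not needed). [ours] -/
theorem acceptanceMass_tangent_sub_le_sq {q : ℝ} (hq : 0 ≤ q) {x : ℝ} (hx : 0 ≤ x) :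
    (gaussianReal 0 1).real (Icc (-(q * Real.sqrt 1)) (q * Real.sqrt 1))
        + (q * gaussianPDFReal 0 1 (q * Real.sqrt 1) / Real.sqrt 1) * (x - 1)
        - (gaussianReal 0 1).real (Icc (-(q * Real.sqrt x)) (q * Real.sqrt x))
      ≤ ((q * gaussianPDFReal 0 1 (q * Real.sqrt (1 / 2)) / Real.sqrt (1 / 2)) * (q ^ 2 / 2 + 1)
          + 4 * (gaussianReal 0 1).real (Icc (-(q * Real.sqrt 1)) (q * Real.sqrt 1))) * (x - 1) ^ 2 := by
  set ψ : ℝ → ℝ := fun x => (gaussianReal 0 1).real (Icc (-(q * Real.sqrt x)) (q * Real.sqrt x)) with hψ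
  set g : ℝ → ℝ := fun x => q * gaussianPDFReal 0 1 (q * Real.sqrt x) / Real.sqrt x with hg
  set L : ℝ := g (1 / 2) * (q ^ 2 / 2 + 1) with hL
  have hψ0 : ∀ y, 0 ≤ ψ y := fun y => measureReal_nonneg
  have hψ1 : 0 ≤ ψ 1 := hψ0 1
  have hL0 : 0 ≤ L := mul_nonneg (acceptanceSlope_nonneg hq _) (by positivity)
  have hg1 : 0 ≤ g 1 := acceptanceSlope_nonneg hq 1
  change ψ 1 + g 1 * (x - 1) - ψ x ≤ (L + 4 * ψ 1) * (x - 1) ^ 2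
  rcases lt_or_ge x (1 / 2) with hlt | hge
  · -- `0 ≤ x < 1/2`: `h ≤ ψ 1 ≤ 4 ψ(1) (x-1)²`
    have h1 : ψ 1 + g 1 * (x - 1) - ψ x ≤ ψ 1 := by
      have : g 1 * (x - 1) ≤ 0 := mul_nonpos_of_nonneg_of_nonpos hg1 (by linarith)
      linarith [hψ0 x]
    have h2 : (1 : ℝ) ≤ 4 * (x - 1) ^ 2 := by nlinarith
    have h3 : ψ 1 ≤ 4 * ψ 1 * (x - 1) ^ 2 := by nlinarith
    nlinarith [sq_nonneg (x - 1)]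
  · -- `x ≥ 1/2`: mean value theorem + Lipschitz bound on the slope
    have hderiv : ∀ y, 0 < y → HasDerivAt ψ (g y) y := fun y hy =>
      hasDerivAt_gaussianReal_real_Icc_sqrt hq hy
    have hlip : ∀ y, 1 / 2 ≤ y → |g y - g 1| ≤ L * |y - 1| := fun y hy =>
      abs_acceptanceSlope_sub_le hq hy (by norm_num)
    rcases lt_trichotomy x 1 with hx1 | rfl | h1x
    · -- `1/2 ≤ x < 1`
      obtain ⟨ξ, hξ, hslope⟩ := exists_hasDerivAt_eq_slope ψ g hx1
        ((continuous_gaussianReal_real_Icc_sqrt hq).continuousOn)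
        (fun y hy => hderiv y (lt_of_lt_of_le (by norm_num) (hge.trans hy.1.le)))
      have hξ' : 1 / 2 ≤ ξ := hge.trans hξ.1.le
      have hx1' : (1 : ℝ) - x ≠ 0 := by linarith
      have hmvt : ψ 1 - ψ x = g ξ * (1 - x) := by
        rw [hslope]; field_simp
      have hgap : ψ 1 + g 1 * (x - 1) - ψ x = (g 1 - g ξ) * (x - 1) := by rw [← sub_eq_zero]; nlinarith [hmvt]
      rw [hgap]
      have hb := hlip ξ hξ'
      have hξ1 : |ξ - 1| ≤ |x - 1| := by
        rw [abs_of_nonpos (by linarith [hξ.2]), abs_of_nonpos (by linarith)]; linarith [hξ.1]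
      calc (g 1 - g ξ) * (x - 1) ≤ |(g 1 - g ξ) * (x - 1)| := le_abs_self _
        _ = |g ξ - g 1| * |x - 1| := by rw [abs_mul, abs_sub_comm]
        _ ≤ L * |x - 1| * |x - 1| := mul_le_mul_of_nonneg_right (hb.trans
            (mul_le_mul_of_nonneg_left hξ1 hL0)) (abs_nonneg _)
        _ = L * (x - 1) ^ 2 := by rw [mul_assoc, ← sq, sq_abs]
        _ ≤ (L + 4 * ψ 1) * (x - 1) ^ 2 := by nlinarith [sq_nonneg (x - 1)]
    · simp
    · -- `x > 1`
      obtain ⟨ξ, hξ, hslope⟩ := exists_hasDerivAt_eq_slope ψ g h1x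
        ((continuous_gaussianReal_real_Icc_sqrt hq).continuousOn)
        (fun y hy => hderiv y (by linarith [hy.1]))
      have hξ' : 1 / 2 ≤ ξ := by linarith [hξ.1]
      have hx1' : x - 1 ≠ 0 := by linarith
      have hmvt : ψ x - ψ 1 = g ξ * (x - 1) := by
        rw [hslope]; field_simp
      have hgap : ψ 1 + g 1 * (x - 1) - ψ x = (g 1 - g ξ) * (x - 1) := by nlinarith [hmvt]
      rw [hgap]
      have hb := hlip ξ hξ'
      have hξ1 : |ξ - 1| ≤ |x - 1| := by
        rw [abs_of_nonneg (by linarith [hξ.1]), abs_of_nonneg (by linarith)]; linarith [hξ.2]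
      calc (g 1 - g ξ) * (x - 1) ≤ |(g 1 - g ξ) * (x - 1)| := le_abs_self _
        _ = |g ξ - g 1| * |x - 1| := by rw [abs_mul, abs_sub_comm]
        _ ≤ L * |x - 1| * |x - 1| := mul_le_mul_of_nonneg_right (hb.trans
            (mul_le_mul_of_nonneg_left hξ1 hL0)) (abs_nonneg _)
        _ = L * (x - 1) ^ 2 := by rw [mul_assoc, ← sq, sq_abs]
        _ ≤ (L + 4 * ψ 1) * (x - 1) ^ 2 := by nlinarith [sq_nonneg (x - 1)]

end Tangent

/-! ## §2 The `O(1/n)` rate -/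

section Rate

/-- **`O(1/n)` RATE OF THE FIXED-COUNT CALIBRATION** (split Student-ratio form): for `q ≥ 0` and
`n ≥ 1`, with `g_q(1/2) = q φ(q/√2)·√2`,
`N(0,1)([−q,q]) − N^{⊗(n+1)}{|z₀| ≤ q√((Σ_{j≥1} z_j²)/n)} ≤ (2 g_q(1/2)(q²/2 + 1) + 8 N(0,1)([−q,q]))/n`.
[ours] -/
theorem gaussianReal_sub_studentRatio_le_inv {q : ℝ} (hq : 0 ≤ q) {n : ℕ} (hn : 1 ≤ n) :
    (gaussianReal 0 1).real (Icc (-q) q)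
        - ((Measure.pi fun _ : Fin (n + 1) => gaussianReal 0 1)
            {z : Fin (n + 1) → ℝ | |z 0| ≤ q * Real.sqrt ((∑ j : Fin n, z j.succ ^ 2) / (n : ℝ))}).toReal
      ≤ (2 * ((q * gaussianPDFReal 0 1 (q * Real.sqrt (1 / 2)) / Real.sqrt (1 / 2)) * (q ^ 2 / 2 + 1))
          + 8 * (gaussianReal 0 1).real (Icc (-q) q)) / (n : ℝ) := by
  rw [pi_gaussianReal_studentRatio_real_eq_integral q n]
  set Q := Measure.pi fun _ : Fin n => gaussianReal 0 1 with hQ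
  set ψ : ℝ → ℝ := fun x => (gaussianReal 0 1).real (Icc (-(q * Real.sqrt x)) (q * Real.sqrt x)) with hψ
  set g1 : ℝ := q * gaussianPDFReal 0 1 (q * Real.sqrt 1) / Real.sqrt 1 with hg1
  set K : ℝ := (q * gaussianPDFReal 0 1 (q * Real.sqrt (1 / 2)) / Real.sqrt (1 / 2)) * (q ^ 2 / 2 + 1)
    + 4 * ψ 1 with hK
  set V : (Fin n → ℝ) → ℝ := fun w => (∑ j, w j ^ 2) / (n : ℝ) with hV
  have hn0 : (n : ℝ) ≠ 0 := by exact_mod_cast (by omega : n ≠ 0)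
  have hψ1 : ψ 1 = (gaussianReal 0 1).real (Icc (-q) q) := by simp [hψ, Real.sqrt_one]
  have hψc : Continuous ψ := continuous_gaussianReal_real_Icc_sqrt hq
  have hψb : ∀ x, |ψ x| ≤ 1 := abs_gaussianReal_real_Icc_sqrt_le_one q
  have hVm : Measurable V := by simp only [hV]; fun_prop
  have hV0 : ∀ w, 0 ≤ V w := fun w =>
    div_nonneg (Finset.sum_nonneg fun j _ => sq_nonneg _) (Nat.cast_nonneg n)
  have hint : Integrable (fun w => ψ (V w)) Q :=
    Integrable.of_bound (hψc.measurable.comp hVm).aestronglyMeasurable 1 (ae_of_all _ fun w => hψb _)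
  have hmemV : MemLp V 2 Q := by
    have : MemLp (fun w : Fin n → ℝ => ∑ j, w j ^ 2) 2 Q :=
      memLp_finsetSum _ fun j _ =>
        (memLp_two_sq_gaussianReal).comp_measurePreserving (measurePreserving_eval _ j)
    exact (this.const_mul (n : ℝ)⁻¹).ae_eq (ae_of_all _ fun w => by
      show (n : ℝ)⁻¹ * ∑ j, w j ^ 2 = (∑ j, w j ^ 2) / (n : ℝ)
      rw [div_eq_inv_mul])
  have hintV : Integrable V Q := hmemV.integrable (by norm_num)
  have hintsq : Integrable (fun w => (V w - 1) ^ 2) Q := (hmemV.sub (memLp_const 1)).integrable_sq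
  have hEV : ∫ w, V w ∂Q = 1 := pi_gaussianReal_integral_meanSq hn
  -- `E (V − 1)² = Var V = 2/n`
  have hE2 : ∫ w, (V w - 1) ^ 2 ∂Q = 2 / (n : ℝ) := by
    have hvar := variance_eq_integral (μ := Q) (X := V) hintV.aemeasurable
    rw [pi_gaussianReal_variance_meanSq hn, hEV] at hvar
    exact hvar.symm
  -- pointwise second-order bound, integrated
  have hpt : ∀ w, ψ 1 + g1 * (V w - 1) - ψ (V w) ≤ K * (V w - 1) ^ 2 := fun w =>
    acceptanceMass_tangent_sub_le_sq hq (hV0 w)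
  have hVs : Integrable (fun w => V w - 1) Q := hintV.sub (integrable_const _)
  have hgV : Integrable (fun w => g1 * (V w - 1)) Q := hVs.const_mul g1
  have h1 : Integrable (fun w => ψ 1 + g1 * (V w - 1)) Q := (integrable_const _).add hgV
  have hlin : ∫ w, (ψ 1 + g1 * (V w - 1) - ψ (V w)) ∂Q = ψ 1 - ∫ w, ψ (V w) ∂Q := by
    have h3 : ∫ w, (V w - 1) ∂Q = 0 := by
      rw [integral_sub hintV (integrable_const _), hEV, integral_const, smul_eq_mul, probReal_univ]
      ring
    have h2 : ∫ w, (ψ 1 + g1 * (V w - 1)) ∂Q = ψ 1 := by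
      rw [integral_add (integrable_const _) hgV, integral_const_mul, h3, integral_const, smul_eq_mul,
        probReal_univ]
      ring
    rw [integral_sub h1 hint, h2]
  rw [← hψ1]
  calc ψ 1 - ∫ w, ψ (V w) ∂Q = ∫ w, (ψ 1 + g1 * (V w - 1) - ψ (V w)) ∂Q := hlin.symm
    _ ≤ ∫ w, K * (V w - 1) ^ 2 ∂Q := integral_mono (h1.sub hint) (hintsq.const_mul _) hpt
    _ = K * (2 / (n : ℝ)) := by rw [integral_const_mul, hE2]
    _ = (2 * ((q * gaussianPDFReal 0 1 (q * Real.sqrt (1 / 2)) / Real.sqrt (1 / 2)) * (q ^ 2 / 2 + 1))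
          + 8 * ψ 1) / (n : ℝ) := by
        rw [hK]; field_simp; ring

end Rate

end Summit.Ventures.LatticeQCDFlow.Scoring
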